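import Summits.QuantumFields.YangMills.Theorems.UnitScaleTiltProp7OneFormPointwiseDecayRate
import HarnessLib

/-!
# Route `UnitScaleTilt`, crux K1 «MinimiserStabilityRegPr» (stmt-QuantumFields-19200), EX row `norm_G` — ★p1 g27 CHAIR WORD №24 road, pen N4:
# **(V) FOR `G₀`: THE SUP→SUP BOUND `‖G₀ f‖_∞ ≤ B·‖f‖_∞` AT THE SLOT OF RECORD, K-FREE SHAPE** — O4-E2E at the explicit rate PER BLOCK-SUPPORTED PIECE of the source, then the coarse volume

Cell `ym3-torus` (HUMAN RULING D-0037; rung R3 = SU(2) YM₃ on T³ — NOT d = 4, NOT infinite volume, NOT a mass gap, NOT Clay).  Width seat `ym3-torus-px16` g13 (first refusal N4,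
CHAIR WORD №24; `--supports stmt-QuantumFields-19200 --as helper`).  THEOREMS ONLY (0 `def`, 0 `sorry`, default heartbeats); count-neutral.

WHY THIS ROAD.  The row-sum of the (K2) kernel row (✓`kernelRow_GT_DeltaEtaSlot_rate`, per-entry `√2A₁·e^{−κ₁·blockdist}`) over the `3ℓ³` bonds of a block is NOT K-free (the E2E entry
bound is flat inside a block while the true kernel is `~ ℓ⁻²∕dist`).  The K-free road: split the source into its BLOCK PIECES `f = Σ_y 1_{B=y}f` — each block-supported with
`Fsrc := √2·s` and A4-block mass `‖toL2(1_y f)‖ ≤ √(2c₀·d(L^d)^{K−n})·s` (= `√6·s` at the pin `c₀ = ℓ⁻³`) — run ✓`pointwiseDecay_oneForm_DeltaEtaSlot_rate` per piece at the EXPLICIT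
rate `κ₁ = min r (1∕4)∕2` (this is why the rate had to be displayed), and sum the decay factors over the coarse torus (✓`sum_exp_neg_mul_tdist_coarse_le`, `(2(1+1∕κ₁))³`).
WHAT IS PROVED (ns `Summit.QuantumFields.YangMills.Theorems.Prop7OneFormGreenSupBound`; member `F`, `n ≤ K`, `ℓ = L^{K−n}`).
* §1 block pieces: `sum_bondBlockPiece_eq` (`Σ_y 1_{B=y}X = X`), `norm_toL2_blockPiece_le` (`‖toL2(1_yX)‖ ≤ √(2c₀d(L^d)^{K−n})·s`), `norm_equiv_toL2_blockPiece_le` (`≤ √2·s` pointwise),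
  `iterBlockOf_eq_of_equiv_toL2_blockPiece_ne_zero` (support).
* §2 ★★★ `norm_symm_GT_apply_le_of_letters` — at the letters of ✓`kernelRow_GT_DeltaEtaSlot_rate` ((γ) `hco`, (C_V) `hVlow`, (θ_V-class) `hVconj`, `0 < Θ`, `hkD`, `hkQ`, `PosOnto`, `RegPr`,
  `hsmall`): `∀ X bd, (∀ b, ‖X b‖ ≤ s) → ‖toL2⁻¹(G₀(toL2 X)) bd‖ ≤ A₂·(2(1+2∕min r (1∕4)))³·s`, `A₂` = E2E's constant at `Fsrc := √2`, `D₀ := e^{6r}√(2c₀d(L^d)^{K−n})∕Θ` — print's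
  Thm 3.3 `|G f| ≤ B|f|` (3.47) in the sup currency for the member's `G₀`, K-free shape.  The letters are the ones D1 ✓∕⧗`kernelRow_GT_DeltaEtaSlot_of_lift` feeds under `Lift`.
USE UNDER `Lift`: feed (C_V) by px21's ⧗`hVlow_abs_of_lift` (ABSOLUTE `C_V`) or D1 ✓`hVlow_of_lift`, (θ_V-class) by px21 ✓`hVconj_phaseClass_of_letters`, `hkQ` by ✓`hkQ_of_regPr`, `PosOnto`
by (γ) + ✓`surjective_Qk_of_regPr` — the 10-line pattern of D1 ✓`kernelRow_GT_DeltaEtaSlot_of_lift` (the `_of_lift` knit of this file follows A2h, so that `C_V` is coupling-free).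
HONEST SCOPE.  Composition of E2E-rate per block; CONDITIONAL on the displayed letters; nothing of `norm_G` (which is about `frakGfR` at `DeltaOnePJ`), the EX rows, EX or the crux is
proved; no summit is proved by a helper.

References: T. Bałaban, CMP **99** (1985) 389–434 [Balaban1985BackgroundPropagators] (Thm 3.3 (3.47) p.398, Thm 3.1 (3.42) p.397, (3.46) p.398, (3.49) p.399, Thm 3.12 p.422).
-/

set_option autoImplicit false

noncomputable section

open scoped Matrix.Norms.L2Operator BigOperators InnerProductSpace ComplexConjugate

namespace Summit.QuantumFields.YangMills.Theorems.Prop7OneFormGreenSupBound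

open Literature.MathematicalPhysics.QuantumFieldTheory.Balaban1983to89
open Literature.MathematicalPhysics.QuantumFieldTheory.Balaban1983to89.T3ContinuumYM3Torus
open Literature.MathematicalPhysics.QuantumFieldTheory.Balaban1983to89.T3PrintedRegularMinimiser (RegPr)
open T3SectALandauChart (formComp bgUnits eta eta_pos)
open B4Sect5Torus (TSite)
open B9SectCLatticeCarrier (Bond)
open B9Eq311L2Pairing (WL2)
open B11Eq103H1Complex (BondL2K)
open B5Eq118OneStroke (iterBlockOf)
open B3Taylor310LocalRemainder (tdist_comm)
open Summit.QuantumFields.YangMills.Theorems.Prop7SectET3Transport (periodsT3 siteEquiv bondEquiv)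
open Summit.QuantumFields.YangMills.Theorems.Prop7SectET3HilbertLetters (W₂ frobEquiv toL2 toL2S DL2 DstarL2 toL2_apply toL2_symm_apply)
open Summit.QuantumFields.YangMills.Theorems.Prop7SectET3WilsonHessian (DeltaEta DeltaEtaSlot)
open Summit.QuantumFields.YangMills.Theorems.Prop7SectET3GaugeProjector (RS)
open Summit.QuantumFields.YangMills.Theorems.Prop7SectET3CurvedPropagators (laplaceA Qk GT PosOnto laplaceA_GT)
open Summit.QuantumFields.YangMills.Theorems.Prop7RieszTauFrobNorm (norm_frobEquiv_le norm_frobEquiv_symm_le sum_norm_sq_le_two_mul_opNorm_sq)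
open Summit.QuantumFields.YangMills.Theorems.Prop7LaplaceAFlatLetters (norm_sq_toL2)
open Summit.QuantumFields.YangMills.Theorems.Prop7OneFormRemainderDecay (card_filter_src_block_eq)
open Summit.QuantumFields.YangMills.Theorems.Prop7BlockDistanceWeights (sum_exp_neg_mul_tdist_coarse_le tdist_coarse_comm)
open Summit.QuantumFields.YangMills.Theorems.Prop7OneFormBlockDecayAll (blockDecay_allBlocks_of_letters eta_sq_exp_sub_one_sq_le)
open Summit.QuantumFields.YangMills.Theorems.Prop7OneFormPointwiseDecayRate (pointwiseDecay_oneForm_DeltaEtaSlot_rate)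

variable {F : T3Family} {n K : ℕ} {c₀ : ℝ}

/-! ## §1 Block pieces of a one-form -/

/-- `Σ_y 1_{B=y}·X = X` pointwise. [folklore] -/
theorem sum_bondBlockPiece_eq (X : PBond (F.P K) 0 → Matrix (Fin 2) (Fin 2) ℂ) :
    (∑ y : Site (F.P K) (K - n), fun b : PBond (F.P K) 0 => if iterBlockOf (K - n) b.src = y then X b else 0) = X := by
  classical
  funext b
  rw [Finset.sum_apply, Finset.sum_ite_eq, if_pos (Finset.mem_univ _)]

/-- `‖toL2(1_{B=y}X)‖ ≤ √(2·c₀·d·(L^d)^{K−n})·s` when `‖X b‖ ≤ s` on the block (✓`norm_sq_toL2`, `Σ_{ij}|X_{ij}|² ≤ 2|X|²`, ✓`card_filter_src_block_eq`).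
[cite: Balaban1985BackgroundPropagators, (3.11) p.392; Balaban1985Averaging, (20) p.21] -/
theorem norm_toL2_blockPiece_le [Fact (0 < c₀)] (X : PBond (F.P K) 0 → Matrix (Fin 2) (Fin 2) ℂ) (y : Site (F.P K) (K - n)) {s : ℝ} (hs : 0 ≤ s)
    (hX : ∀ b, ‖X b‖ ≤ s) :
    ‖toL2 F K c₀ (fun b : PBond (F.P K) 0 => if iterBlockOf (K - n) b.src = y then X b else 0)‖
      ≤ Real.sqrt (2 * c₀ * (((F.P K).d : ℝ) * ((((F.P K).L : ℝ) ^ (F.P K).d) ^ (K - n)))) * s := by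
  classical
  have hc₀ : 0 < c₀ := Fact.out
  have hsq : ‖toL2 F K c₀ (fun b : PBond (F.P K) 0 => if iterBlockOf (K - n) b.src = y then X b else 0)‖ ^ 2
      ≤ (Real.sqrt (2 * c₀ * (((F.P K).d : ℝ) * ((((F.P K).L : ℝ) ^ (F.P K).d) ^ (K - n)))) * s) ^ 2 := by
    rw [norm_sq_toL2, mul_pow, Real.sq_sqrt (by positivity)]
    have hterm : ∀ b : PBond (F.P K) 0, (∑ i, ∑ i', ‖(if iterBlockOf (K - n) b.src = y then X b else 0) i i'‖ ^ 2)
        ≤ if iterBlockOf (K - n) b.src = y then 2 * s ^ 2 else 0 := by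
      intro b
      split_ifs with hb
      · exact (sum_norm_sq_le_two_mul_opNorm_sq (X b)).trans (by nlinarith [hX b, norm_nonneg (X b)])
      · simp
    calc c₀ * ∑ b : PBond (F.P K) 0, ∑ i, ∑ i', ‖(if iterBlockOf (K - n) b.src = y then X b else 0) i i'‖ ^ 2
        ≤ c₀ * ∑ b : PBond (F.P K) 0, (if iterBlockOf (K - n) b.src = y then 2 * s ^ 2 else 0) :=
          mul_le_mul_of_nonneg_left (Finset.sum_le_sum fun b _ => hterm b) hc₀.le
      _ = c₀ * (((Finset.univ.filter fun b : PBond (F.P K) 0 => iterBlockOf (K - n) b.src = y).card : ℝ) * (2 * s ^ 2)) := by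
          rw [Finset.sum_ite, Finset.sum_const_zero, add_zero, Finset.sum_const, nsmul_eq_mul]
      _ = 2 * c₀ * (((F.P K).d : ℝ) * ((((F.P K).L : ℝ) ^ (F.P K).d) ^ (K - n))) * s ^ 2 := by rw [card_filter_src_block_eq]; ring
  exact (pow_le_pow_iff_left₀ (norm_nonneg _) (by positivity) two_ne_zero).mp hsq

/-- `‖(toL2(1_{B=y}X))(p)‖ ≤ √2·s` at every lit bond. [cite: Balaban1985Averaging, (20) p.21] -/
theorem norm_equiv_toL2_blockPiece_le (X : PBond (F.P K) 0 → Matrix (Fin 2) (Fin 2) ℂ) (y : Site (F.P K) (K - n)) {s : ℝ} (hs : 0 ≤ s)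
    (hX : ∀ b, ‖X b‖ ≤ s) (p : Bond 3 (periodsT3 F K)) :
    ‖WL2.equiv ℂ _ W₂ (toL2 F K c₀ (fun b : PBond (F.P K) 0 => if iterBlockOf (K - n) b.src = y then X b else 0)) p‖ ≤ Real.sqrt 2 * s := by
  classical
  rw [toL2_apply]
  split_ifs with hb
  · exact (norm_frobEquiv_symm_le _).trans (mul_le_mul_of_nonneg_left (hX _) (Real.sqrt_nonneg _))
  · rw [map_zero, norm_zero]; positivity

/-- SUPPORT of a block piece read on the lit carrier. [folklore] -/
theorem iterBlockOf_eq_of_equiv_toL2_blockPiece_ne_zero (X : PBond (F.P K) 0 → Matrix (Fin 2) (Fin 2) ℂ) (y : Site (F.P K) (K - n)) (p : Bond 3 (periodsT3 F K))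
    (hp : WL2.equiv ℂ _ W₂ (toL2 F K c₀ (fun b : PBond (F.P K) 0 => if iterBlockOf (K - n) b.src = y then X b else 0)) p ≠ 0) :
    iterBlockOf (K - n) ((bondEquiv F K).symm p).src = y := by
  classical
  rw [toL2_apply] at hp
  by_contra hne
  rw [if_neg hne, map_zero] at hp
  exact hp rfl

/-! ## §2 The sup bound of `G₀` at the letters -/

variable [Fact (0 < c₀)] {h : n ≤ K} {cB a : ℝ} [Fact (0 < cB)]

/-- ★★★ **(V) FOR `G₀`: `‖toL2⁻¹(G₀(toL2 X)) bd‖ ≤ A₂·(2(1+2∕min r (1∕4)))³·s` WHENEVER `‖X b‖ ≤ s`** — at the letters of ✓`kernelRow_GT_DeltaEtaSlot_rate` (`RegPr`, `PosOnto`, (γ) `hco`,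
(C_V) `hVlow`, (θ_V-class) `hVconj`, `0 < Θ`, `hkD`, `hkQ` at rate `μ′ > r`, `(32√2ε₀e^{5r})(8e^{3r})·14 < 1`); `A₂` = E2E's constant at `Fsrc := √2`,
`D₀ := e^{6r}√(2c₀d(L^d)^{K−n})∕Θ`.  PROOF: `X = Σ_y 1_{B=y}X`; per piece ✓`pointwiseDecay_oneForm_DeltaEtaSlot_rate` (source letters §1, `hD` by A4b ✓`blockDecay_allBlocks_of_letters` ÷ Θ),
homogeneity of the constant in `s`, then ✓`sum_exp_neg_mul_tdist_coarse_le` at the rate `min r (1∕4)∕2`.  CONDITIONAL on every displayed letter.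
[cite: Balaban1985BackgroundPropagators, Thm 3.3 (3.47) p.398, Thm 3.1 (3.42) p.397, (3.46) p.398, Thm 3.12 p.422] -/
theorem norm_symm_GT_apply_le_of_letters (hnK : n ≤ K) {ε₀ : ℝ} (hε₀ : 0 ≤ ε₀) (U₀ : GaugeField (F.P K) 0 (Matrix.specialUnitaryGroup (Fin 2) ℂ)) (hreg : RegPr F n K ε₀ U₀)
    (hp : PosOnto F n K h c₀ cB a (DeltaEtaSlot F n K c₀) U₀)
    {r : ℝ} (hr : 0 < r) {γ CV θV ε : ℝ} (hε : 0 < ε) (hε1 : ε ≤ 1)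
    (hco : ∀ v : BondL2K ℂ 3 (periodsT3 F K) c₀ W₂, γ * ‖v‖ ^ 2 ≤ RCLike.re ⟪v, laplaceA F n K h c₀ cB a (DeltaEtaSlot F n K c₀) U₀ v⟫_ℂ)
    (hVlow : ∀ X : PBond (F.P K) 0 → Matrix (Fin 2) (Fin 2) ℂ,
      -(CV * ‖toL2 F K c₀ X‖ ^ 2) ≤ RCLike.re ⟪toL2 F K c₀ X, laplaceA F n K h c₀ cB a (DeltaEtaSlot F n K c₀) U₀ (toL2 F K c₀ X)⟫_ℂ
        - ∑ μ : Fin (F.P K).d, ‖DL2 F n K c₀ U₀ (toL2S F K c₀ (formComp X μ))‖ ^ 2)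
    (hVconj : ∀ φ : Site (F.P K) 0 → ℝ, (∀ x x' : Site (F.P K) 0, |φ x - φ x'| ≤ r * eta F n K * (Site.tdist x x' : ℝ)) →
      ∀ X : PBond (F.P K) 0 → Matrix (Fin 2) (Fin 2) ℂ,
      RCLike.re ⟪toL2 F K c₀ X, laplaceA F n K h c₀ cB a (DeltaEtaSlot F n K c₀) U₀ (toL2 F K c₀ X)⟫_ℂ
          - (∑ μ : Fin (F.P K).d, ‖DL2 F n K c₀ U₀ (toL2S F K c₀ (formComp X μ))‖ ^ 2) - θV * ‖toL2 F K c₀ X‖ ^ 2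
        ≤ RCLike.re ⟪toL2 F K c₀ (fun b => Real.exp (φ b.src) • X b), laplaceA F n K h c₀ cB a (DeltaEtaSlot F n K c₀) U₀ (toL2 F K c₀ (fun b => (Real.exp (φ b.src))⁻¹ • X b))⟫_ℂ
          - RCLike.re (∑ μ : Fin (F.P K).d, ⟪DL2 F n K c₀ U₀ (toL2S F K c₀ (formComp (fun b => Real.exp (φ b.src) • X b) μ)),
              DL2 F n K c₀ U₀ (toL2S F K c₀ (formComp (fun b => (Real.exp (φ b.src))⁻¹ • X b) μ))⟫_ℂ))
    (hΘ : 0 < ((1 - ε) * γ - ε * CV - 3 * (r ^ 2 * Real.exp (2 * r)) * (1 + 1 / ε) - θV))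
    {CkD CkQ μ' : ℝ} (hCkD : 0 ≤ CkD) (hCkQ : 0 ≤ CkQ) (hrμ : r < μ')
    (hkD : ∀ (b : PBond (F.P K) 0) (Z : Matrix (Fin 2) (Fin 2) ℂ) (bd : PBond (F.P K) 0),
      ‖(toL2 F K c₀).symm (DL2 F n K c₀ U₀ (DstarL2 F n K c₀ U₀ (toL2 F K c₀ (Pi.single b Z))
          - RS F n K h c₀ cB U₀ (DstarL2 F n K c₀ U₀ (toL2 F K c₀ (Pi.single b Z))))) bd‖
        ≤ CkD * Real.exp (-(μ' * (Site.tdist (P := F.P K) (iterBlockOf (K - n) b.src) (iterBlockOf (K - n) bd.src) : ℝ))) * ‖Z‖)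
    (hkQ : ∀ (b : PBond (F.P K) 0) (Z : Matrix (Fin 2) (Fin 2) ℂ) (bd : PBond (F.P K) 0),
      ‖(toL2 F K c₀).symm (LinearMap.adjoint (Qk F n K h c₀ cB U₀) (((a : ℝ) : ℂ) • Qk F n K h c₀ cB U₀ (toL2 F K c₀ (Pi.single b Z)))) bd‖
        ≤ CkQ * Real.exp (-(μ' * (Site.tdist (P := F.P K) (iterBlockOf (K - n) b.src) (iterBlockOf (K - n) bd.src) : ℝ))) * ‖Z‖)
    (hsmall : (32 * Real.sqrt 2 * ε₀ * Real.exp (5 * r)) * (8 * Real.exp (3 * r)) * 14 < 1)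
    (X : PBond (F.P K) 0 → Matrix (Fin 2) (Fin 2) ℂ) {s : ℝ} (hs : 0 ≤ s) (hX : ∀ b, ‖X b‖ ≤ s) (bd : PBond (F.P K) 0) :
    ‖(toL2 F K c₀).symm (GT F n K h c₀ cB a (DeltaEtaSlot F n K c₀) U₀ (toL2 F K c₀ X)) bd‖
      ≤ (((Real.sqrt 2 + Real.sqrt 2 * ((CkQ + CkD) * Real.sqrt (((F.P K).d : ℝ) * ((((F.P K).L : ℝ) ^ (F.P K).d) ^ (K - n)) / c₀) * (Real.exp (6 * r) * Real.sqrt (2 * c₀ * (((F.P K).d : ℝ) * ((((F.P K).L : ℝ) ^ (F.P K).d) ^ (K - n)))) / ((1 - ε) * γ - ε * CV - 3 * (r ^ 2 * Real.exp (2 * r)) * (1 + 1 / ε) - θV)) * (2 * (1 + 1 / (μ' - r))) ^ 3)) * (8 * Real.exp (3 * r)) * 14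
              + Real.sqrt (3 ^ 3 * 8 / (c₀ * ((F.L : ℝ) ^ (K - n)) ^ 3)) * (Real.sqrt (8 * Real.exp (3 * r) * (2 * (1 + 1 / r)) ^ 3) * (Real.exp (6 * r) * Real.sqrt (2 * c₀ * (((F.P K).d : ℝ) * ((((F.P K).L : ℝ) ^ (F.P K).d) ^ (K - n)))) / ((1 - ε) * γ - ε * CV - 3 * (r ^ 2 * Real.exp (2 * r)) * (1 + 1 / ε) - θV))))
            / (1 - (32 * Real.sqrt 2 * ε₀ * Real.exp (5 * r)) * (8 * Real.exp (3 * r)) * 14))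
        * (2 * (1 + 1 / (min r (1 / 4) / 2))) ^ 3 * s := by
  classical
  have hc₀ : 0 < c₀ := Fact.out
  set Θ : ℝ := ((1 - ε) * γ - ε * CV - 3 * (r ^ 2 * Real.exp (2 * r)) * (1 + 1 / ε) - θV) with hΘdef
  set D₁ : ℝ := Real.exp (6 * r) * Real.sqrt (2 * c₀ * (((F.P K).d : ℝ) * ((((F.P K).L : ℝ) ^ (F.P K).d) ^ (K - n)))) / Θ with hD₁def
  have hD₁ : 0 ≤ D₁ := by rw [hD₁def]; exact div_nonneg (by positivity) hΘ.le
  set N : ℝ := Real.sqrt (((F.P K).d : ℝ) * ((((F.P K).L : ℝ) ^ (F.P K).d) ^ (K - n)) / c₀) with hN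
  set Vr : ℝ := (2 * (1 + 1 / (μ' - r))) ^ 3 with hVr
  have hμr : 0 < μ' - r := by linarith
  have hVr0 : 0 ≤ Vr := by rw [hVr]; positivity
  have hden : 0 < 1 - (32 * Real.sqrt 2 * ε₀ * Real.exp (5 * r)) * (8 * Real.exp (3 * r)) * 14 := by linarith
  set A₂ : ℝ := (((Real.sqrt 2 + Real.sqrt 2 * ((CkQ + CkD) * N * D₁ * Vr)) * (8 * Real.exp (3 * r)) * 14
        + Real.sqrt (3 ^ 3 * 8 / (c₀ * ((F.L : ℝ) ^ (K - n)) ^ 3)) * (Real.sqrt (8 * Real.exp (3 * r) * (2 * (1 + 1 / r)) ^ 3) * D₁))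
      / (1 - (32 * Real.sqrt 2 * ε₀ * Real.exp (5 * r)) * (8 * Real.exp (3 * r)) * 14)) with hA₂def
  have hA₂ : 0 ≤ A₂ := by rw [hA₂def]; exact div_nonneg (by positivity) hden.le
  set κ₁ : ℝ := min r (1 / 4) / 2 with hκ₁
  have hκ₁0 : 0 < κ₁ := by rw [hκ₁]; exact div_pos (lt_min hr (by norm_num)) two_pos
  -- A4b's `Θ` dominates the K-free floor
  have hΘle : Θ ≤ (1 - ε) * γ - ε * CV - 3 * ((eta F n K)⁻¹) ^ 2 * (Real.exp (r * eta F n K) - 1) ^ 2 * (1 + 1 / ε) - θV := by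
    have h1 := eta_sq_exp_sub_one_sq_le F n K hr.le
    have h2 : 0 ≤ 1 + 1 / ε := by positivity
    have h3 : 3 * (((eta F n K)⁻¹) ^ 2 * (Real.exp (r * eta F n K) - 1) ^ 2) * (1 + 1 / ε) ≤ 3 * (r ^ 2 * Real.exp (2 * r)) * (1 + 1 / ε) :=
      mul_le_mul_of_nonneg_right (mul_le_mul_of_nonneg_left h1 (by norm_num)) h2
    rw [hΘdef]; linarith
  have hΘA : 0 ≤ (1 - ε) * γ - ε * CV - 3 * ((eta F n K)⁻¹) ^ 2 * (Real.exp (r * eta F n K) - 1) ^ 2 * (1 + 1 / ε) - θV := hΘ.le.trans hΘle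
  -- PER BLOCK PIECE: the decayed bound at `bd`
  have hpiece : ∀ y : Site (F.P K) (K - n),
      ‖(toL2 F K c₀).symm (GT F n K h c₀ cB a (DeltaEtaSlot F n K c₀) U₀
          (toL2 F K c₀ (fun b : PBond (F.P K) 0 => if iterBlockOf (K - n) b.src = y then X b else 0))) bd‖
        ≤ s * A₂ * Real.exp (-(κ₁ * (Site.tdist (iterBlockOf (K - n) bd.src) y : ℝ))) := by
    intro y
    set Xy : PBond (F.P K) 0 → Matrix (Fin 2) (Fin 2) ℂ := fun b => if iterBlockOf (K - n) b.src = y then X b else 0 with hXy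
    set f : BondL2K ℂ 3 (periodsT3 F K) c₀ W₂ := toL2 F K c₀ Xy with hf
    set u : BondL2K ℂ 3 (periodsT3 F K) c₀ W₂ := GT F n K h c₀ cB a (DeltaEtaSlot F n K c₀) U₀ f with hu
    have hu' : laplaceA F n K h c₀ cB a (DeltaEtaSlot F n K c₀) U₀ u = f := laplaceA_GT hp f
    have hfb : ∀ p, ‖WL2.equiv ℂ _ W₂ f p‖ ≤ Real.sqrt 2 * s := fun p => norm_equiv_toL2_blockPiece_le X y hs hX p
    have hfs : ∀ p, WL2.equiv ℂ _ W₂ f p ≠ 0 → iterBlockOf (K - n) ((bondEquiv F K).symm p).src = y := fun p hp0 =>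
      iterBlockOf_eq_of_equiv_toL2_blockPiece_ne_zero X y p hp0
    have hXf : ∀ b' : PBond (F.P K) 0, Xy b' ≠ 0 → iterBlockOf (K - n) b'.src = y := by
      intro b' hb'
      by_contra hne
      rw [hXy] at hb'; dsimp only at hb'
      rw [if_neg hne] at hb'
      exact hb' rfl
    have hnf : ‖toL2 F K c₀ Xy‖ ≤ Real.sqrt (2 * c₀ * (((F.P K).d : ℝ) * ((((F.P K).L : ℝ) ^ (F.P K).d) ^ (K - n)))) * s := norm_toL2_blockPiece_le X y hs hX
    have hD : ∀ y' : Site (F.P K) (K - n),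
        ‖toL2 F K c₀ (fun b' => if iterBlockOf (K - n) b'.src = y' then (toL2 F K c₀).symm u b' else 0)‖ ≤ (D₁ * s) * Real.exp (-(r * (Site.tdist y' y : ℝ))) := by
      intro y'
      have hA4 := blockDecay_allBlocks_of_letters (h := h) (cB := cB) (a := a) (Δx := DeltaEtaSlot F n K c₀) hnK U₀ hr.le hε hε1 hco hVlow hVconj hΘA
        Xy y hXf u hu' y'
      have hnum : Θ * ‖toL2 F K c₀ (fun b' => if iterBlockOf (K - n) b'.src = y' then (toL2 F K c₀).symm u b' else 0)‖
          ≤ Real.exp (6 * r) * Real.exp (-(r * (Site.tdist y' y : ℝ))) * (Real.sqrt (2 * c₀ * (((F.P K).d : ℝ) * ((((F.P K).L : ℝ) ^ (F.P K).d) ^ (K - n)))) * s) :=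
        (mul_le_mul_of_nonneg_right hΘle (norm_nonneg _)).trans (hA4.trans (mul_le_mul_of_nonneg_left hnf (by positivity)))
      rw [← le_div_iff₀' hΘ] at hnum
      refine hnum.trans (le_of_eq ?_)
      rw [hD₁def]; ring
    have hE := pointwiseDecay_oneForm_DeltaEtaSlot_rate (h := h) (cB := cB) (a := a) hnK hε₀ U₀ hreg hu' y hfb hfs hr (by positivity : 0 ≤ D₁ * s) hD
      hCkD hCkQ hrμ hkD hkQ hsmall (bondEquiv F K bd)
    rw [Equiv.symm_apply_apply] at hE
    rw [toL2_symm_apply]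
    refine (norm_frobEquiv_le _).trans (hE.trans (le_of_eq ?_))
    rw [hA₂def, hκ₁]; ring
  -- SUM OVER THE BLOCKS
  have hsplit : (toL2 F K c₀).symm (GT F n K h c₀ cB a (DeltaEtaSlot F n K c₀) U₀ (toL2 F K c₀ X)) bd
      = ∑ y : Site (F.P K) (K - n), (toL2 F K c₀).symm (GT F n K h c₀ cB a (DeltaEtaSlot F n K c₀) U₀
          (toL2 F K c₀ (fun b : PBond (F.P K) 0 => if iterBlockOf (K - n) b.src = y then X b else 0))) bd := by
    conv_lhs => rw [← sum_bondBlockPiece_eq (n := n) X]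
    rw [map_sum, map_sum, map_sum, Finset.sum_apply]
  have hvol := sum_exp_neg_mul_tdist_coarse_le F (n := n) (K := K) hκ₁0 (iterBlockOf (K - n) bd.src)
  calc ‖(toL2 F K c₀).symm (GT F n K h c₀ cB a (DeltaEtaSlot F n K c₀) U₀ (toL2 F K c₀ X)) bd‖
      ≤ ∑ y : Site (F.P K) (K - n), s * A₂ * Real.exp (-(κ₁ * (Site.tdist (iterBlockOf (K - n) bd.src) y : ℝ))) := by
        rw [hsplit]; exact (norm_sum_le _ _).trans (Finset.sum_le_sum fun y _ => hpiece y)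
    _ = s * A₂ * ∑ y : Site (F.P K) (K - n), Real.exp (-(κ₁ * (Site.tdist y (iterBlockOf (K - n) bd.src) : ℝ))) := by
        rw [Finset.mul_sum]
        refine Finset.sum_congr rfl fun y _ => ?_
        rw [tdist_coarse_comm F (iterBlockOf (K - n) bd.src) y]
    _ ≤ s * A₂ * (2 * (1 + 1 / κ₁)) ^ 3 := mul_le_mul_of_nonneg_left hvol (by positivity)
    _ = _ := by rw [hA₂def, hκ₁]; ring

/-! ## §3 (v1.2, append) The per-block decayed edition, exported (the `hpiece` of §2) -/

/-- ★★ **THE DECAYED SUP BOUND FOR A BLOCK-SUPPORTED SOURCE**: at the letters of §2, if `X` is supported on the bonds of the block `y` (`X b ≠ 0 → B b₋ = y`) with `‖X b‖ ≤ s`, then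
`‖toL2⁻¹(G₀(toL2 X)) bd‖ ≤ s·A₂·e^{−(min r (1∕4)∕2)·tdist(B bd₋, y)}` at every bond (the summand of §2 before the coarse volume; the input of the block-L¹ column bound (K2-L1)).
CONDITIONAL on every displayed letter. [cite: Balaban1985BackgroundPropagators, Thm 3.1 (3.42) p.397, (3.46) p.398, Thm 3.12 p.422] -/
theorem norm_symm_GT_apply_le_of_blockSupport (hnK : n ≤ K) {ε₀ : ℝ} (hε₀ : 0 ≤ ε₀) (U₀ : GaugeField (F.P K) 0 (Matrix.specialUnitaryGroup (Fin 2) ℂ)) (hreg : RegPr F n K ε₀ U₀)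
    (hp : PosOnto F n K h c₀ cB a (DeltaEtaSlot F n K c₀) U₀)
    {r : ℝ} (hr : 0 < r) {γ CV θV ε : ℝ} (hε : 0 < ε) (hε1 : ε ≤ 1)
    (hco : ∀ v : BondL2K ℂ 3 (periodsT3 F K) c₀ W₂, γ * ‖v‖ ^ 2 ≤ RCLike.re ⟪v, laplaceA F n K h c₀ cB a (DeltaEtaSlot F n K c₀) U₀ v⟫_ℂ)
    (hVlow : ∀ X : PBond (F.P K) 0 → Matrix (Fin 2) (Fin 2) ℂ,
      -(CV * ‖toL2 F K c₀ X‖ ^ 2) ≤ RCLike.re ⟪toL2 F K c₀ X, laplaceA F n K h c₀ cB a (DeltaEtaSlot F n K c₀) U₀ (toL2 F K c₀ X)⟫_ℂ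
        - ∑ μ : Fin (F.P K).d, ‖DL2 F n K c₀ U₀ (toL2S F K c₀ (formComp X μ))‖ ^ 2)
    (hVconj : ∀ φ : Site (F.P K) 0 → ℝ, (∀ x x' : Site (F.P K) 0, |φ x - φ x'| ≤ r * eta F n K * (Site.tdist x x' : ℝ)) →
      ∀ X : PBond (F.P K) 0 → Matrix (Fin 2) (Fin 2) ℂ,
      RCLike.re ⟪toL2 F K c₀ X, laplaceA F n K h c₀ cB a (DeltaEtaSlot F n K c₀) U₀ (toL2 F K c₀ X)⟫_ℂ
          - (∑ μ : Fin (F.P K).d, ‖DL2 F n K c₀ U₀ (toL2S F K c₀ (formComp X μ))‖ ^ 2) - θV * ‖toL2 F K c₀ X‖ ^ 2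
        ≤ RCLike.re ⟪toL2 F K c₀ (fun b => Real.exp (φ b.src) • X b), laplaceA F n K h c₀ cB a (DeltaEtaSlot F n K c₀) U₀ (toL2 F K c₀ (fun b => (Real.exp (φ b.src))⁻¹ • X b))⟫_ℂ
          - RCLike.re (∑ μ : Fin (F.P K).d, ⟪DL2 F n K c₀ U₀ (toL2S F K c₀ (formComp (fun b => Real.exp (φ b.src) • X b) μ)),
              DL2 F n K c₀ U₀ (toL2S F K c₀ (formComp (fun b => (Real.exp (φ b.src))⁻¹ • X b) μ))⟫_ℂ))
    (hΘ : 0 < ((1 - ε) * γ - ε * CV - 3 * (r ^ 2 * Real.exp (2 * r)) * (1 + 1 / ε) - θV))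
    {CkD CkQ μ' : ℝ} (hCkD : 0 ≤ CkD) (hCkQ : 0 ≤ CkQ) (hrμ : r < μ')
    (hkD : ∀ (b : PBond (F.P K) 0) (Z : Matrix (Fin 2) (Fin 2) ℂ) (bd : PBond (F.P K) 0),
      ‖(toL2 F K c₀).symm (DL2 F n K c₀ U₀ (DstarL2 F n K c₀ U₀ (toL2 F K c₀ (Pi.single b Z))
          - RS F n K h c₀ cB U₀ (DstarL2 F n K c₀ U₀ (toL2 F K c₀ (Pi.single b Z))))) bd‖
        ≤ CkD * Real.exp (-(μ' * (Site.tdist (P := F.P K) (iterBlockOf (K - n) b.src) (iterBlockOf (K - n) bd.src) : ℝ))) * ‖Z‖)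
    (hkQ : ∀ (b : PBond (F.P K) 0) (Z : Matrix (Fin 2) (Fin 2) ℂ) (bd : PBond (F.P K) 0),
      ‖(toL2 F K c₀).symm (LinearMap.adjoint (Qk F n K h c₀ cB U₀) (((a : ℝ) : ℂ) • Qk F n K h c₀ cB U₀ (toL2 F K c₀ (Pi.single b Z)))) bd‖
        ≤ CkQ * Real.exp (-(μ' * (Site.tdist (P := F.P K) (iterBlockOf (K - n) b.src) (iterBlockOf (K - n) bd.src) : ℝ))) * ‖Z‖)
    (hsmall : (32 * Real.sqrt 2 * ε₀ * Real.exp (5 * r)) * (8 * Real.exp (3 * r)) * 14 < 1)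
    (X : PBond (F.P K) 0 → Matrix (Fin 2) (Fin 2) ℂ) (y : Site (F.P K) (K - n)) (hXy : ∀ b, X b ≠ 0 → iterBlockOf (K - n) b.src = y)
    {s : ℝ} (hs : 0 ≤ s) (hX : ∀ b, ‖X b‖ ≤ s) (bd : PBond (F.P K) 0) :
    ‖(toL2 F K c₀).symm (GT F n K h c₀ cB a (DeltaEtaSlot F n K c₀) U₀ (toL2 F K c₀ X)) bd‖
      ≤ s * (((Real.sqrt 2 + Real.sqrt 2 * ((CkQ + CkD) * Real.sqrt (((F.P K).d : ℝ) * ((((F.P K).L : ℝ) ^ (F.P K).d) ^ (K - n)) / c₀) * (Real.exp (6 * r) * Real.sqrt (2 * c₀ * (((F.P K).d : ℝ) * ((((F.P K).L : ℝ) ^ (F.P K).d) ^ (K - n)))) / ((1 - ε) * γ - ε * CV - 3 * (r ^ 2 * Real.exp (2 * r)) * (1 + 1 / ε) - θV)) * (2 * (1 + 1 / (μ' - r))) ^ 3)) * (8 * Real.exp (3 * r)) * 14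
              + Real.sqrt (3 ^ 3 * 8 / (c₀ * ((F.L : ℝ) ^ (K - n)) ^ 3)) * (Real.sqrt (8 * Real.exp (3 * r) * (2 * (1 + 1 / r)) ^ 3) * (Real.exp (6 * r) * Real.sqrt (2 * c₀ * (((F.P K).d : ℝ) * ((((F.P K).L : ℝ) ^ (F.P K).d) ^ (K - n)))) / ((1 - ε) * γ - ε * CV - 3 * (r ^ 2 * Real.exp (2 * r)) * (1 + 1 / ε) - θV))))
            / (1 - (32 * Real.sqrt 2 * ε₀ * Real.exp (5 * r)) * (8 * Real.exp (3 * r)) * 14))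
        * Real.exp (-((min r (1 / 4) / 2) * (Site.tdist (iterBlockOf (K - n) bd.src) y : ℝ))) := by
  classical
  have hc₀ : 0 < c₀ := Fact.out
  -- `X` IS its own block piece at `y`
  have hXeq : (fun b : PBond (F.P K) 0 => if iterBlockOf (K - n) b.src = y then X b else 0) = X := by
    funext b
    by_cases hb : iterBlockOf (K - n) b.src = y
    · rw [if_pos hb]
    · rw [if_neg hb]
      by_contra hne
      exact hb (hXy b (Ne.symm hne))
  set Θ : ℝ := ((1 - ε) * γ - ε * CV - 3 * (r ^ 2 * Real.exp (2 * r)) * (1 + 1 / ε) - θV) with hΘdef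
  set D₁ : ℝ := Real.exp (6 * r) * Real.sqrt (2 * c₀ * (((F.P K).d : ℝ) * ((((F.P K).L : ℝ) ^ (F.P K).d) ^ (K - n)))) / Θ with hD₁def
  have hD₁ : 0 ≤ D₁ := by rw [hD₁def]; exact div_nonneg (by positivity) hΘ.le
  have hμr : 0 < μ' - r := by linarith
  have hden : 0 < 1 - (32 * Real.sqrt 2 * ε₀ * Real.exp (5 * r)) * (8 * Real.exp (3 * r)) * 14 := by linarith
  have hΘle : Θ ≤ (1 - ε) * γ - ε * CV - 3 * ((eta F n K)⁻¹) ^ 2 * (Real.exp (r * eta F n K) - 1) ^ 2 * (1 + 1 / ε) - θV := by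
    have h1 := eta_sq_exp_sub_one_sq_le F n K hr.le
    have h2 : 0 ≤ 1 + 1 / ε := by positivity
    have h3 : 3 * (((eta F n K)⁻¹) ^ 2 * (Real.exp (r * eta F n K) - 1) ^ 2) * (1 + 1 / ε) ≤ 3 * (r ^ 2 * Real.exp (2 * r)) * (1 + 1 / ε) :=
      mul_le_mul_of_nonneg_right (mul_le_mul_of_nonneg_left h1 (by norm_num)) h2
    rw [hΘdef]; linarith
  have hΘA : 0 ≤ (1 - ε) * γ - ε * CV - 3 * ((eta F n K)⁻¹) ^ 2 * (Real.exp (r * eta F n K) - 1) ^ 2 * (1 + 1 / ε) - θV := hΘ.le.trans hΘle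
  set f : BondL2K ℂ 3 (periodsT3 F K) c₀ W₂ := toL2 F K c₀ X with hf
  set u : BondL2K ℂ 3 (periodsT3 F K) c₀ W₂ := GT F n K h c₀ cB a (DeltaEtaSlot F n K c₀) U₀ f with hu
  have hu' : laplaceA F n K h c₀ cB a (DeltaEtaSlot F n K c₀) U₀ u = f := laplaceA_GT hp f
  have hfb : ∀ p, ‖WL2.equiv ℂ _ W₂ f p‖ ≤ Real.sqrt 2 * s := fun p => by
    have := norm_equiv_toL2_blockPiece_le (c₀ := c₀) X y hs hX p
    rwa [hXeq] at this
  have hfs : ∀ p, WL2.equiv ℂ _ W₂ f p ≠ 0 → iterBlockOf (K - n) ((bondEquiv F K).symm p).src = y := fun p hp0 => by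
    have := iterBlockOf_eq_of_equiv_toL2_blockPiece_ne_zero (c₀ := c₀) X y p
    rw [hXeq] at this
    exact this hp0
  have hnf : ‖toL2 F K c₀ X‖ ≤ Real.sqrt (2 * c₀ * (((F.P K).d : ℝ) * ((((F.P K).L : ℝ) ^ (F.P K).d) ^ (K - n)))) * s := by
    have := norm_toL2_blockPiece_le (c₀ := c₀) X y hs hX
    rwa [hXeq] at this
  have hD : ∀ y' : Site (F.P K) (K - n),
      ‖toL2 F K c₀ (fun b' => if iterBlockOf (K - n) b'.src = y' then (toL2 F K c₀).symm u b' else 0)‖ ≤ (D₁ * s) * Real.exp (-(r * (Site.tdist y' y : ℝ))) := by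
    intro y'
    have hA4 := blockDecay_allBlocks_of_letters (h := h) (cB := cB) (a := a) (Δx := DeltaEtaSlot F n K c₀) hnK U₀ hr.le hε hε1 hco hVlow hVconj hΘA
      X y hXy u hu' y'
    have hnum : Θ * ‖toL2 F K c₀ (fun b' => if iterBlockOf (K - n) b'.src = y' then (toL2 F K c₀).symm u b' else 0)‖
        ≤ Real.exp (6 * r) * Real.exp (-(r * (Site.tdist y' y : ℝ))) * (Real.sqrt (2 * c₀ * (((F.P K).d : ℝ) * ((((F.P K).L : ℝ) ^ (F.P K).d) ^ (K - n)))) * s) :=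
      (mul_le_mul_of_nonneg_right hΘle (norm_nonneg _)).trans (hA4.trans (mul_le_mul_of_nonneg_left hnf (by positivity)))
    rw [← le_div_iff₀' hΘ] at hnum
    refine hnum.trans (le_of_eq ?_)
    rw [hD₁def]; ring
  have hE := pointwiseDecay_oneForm_DeltaEtaSlot_rate (h := h) (cB := cB) (a := a) hnK hε₀ U₀ hreg hu' y hfb hfs hr (by positivity : 0 ≤ D₁ * s) hD
    hCkD hCkQ hrμ hkD hkQ hsmall (bondEquiv F K bd)
  rw [Equiv.symm_apply_apply] at hE
  rw [toL2_symm_apply]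
  refine (norm_frobEquiv_le _).trans (hE.trans (le_of_eq ?_))
  ring

end Summit.QuantumFields.YangMills.Theorems.Prop7OneFormGreenSupBound

end
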